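import Literature.AlgebraicGeometry.Frobenioids.Cor54RigidityLinearCocycle
import Literature.AlgebraicGeometry.Frobenioids.ArithmeticRealificationCoordinates
import Literature.AlgebraicGeometry.Frobenioids.ArithmeticFrobenioidModel
import Literature.AlgebraicGeometry.Frobenioids.RlfStructure
import HarnessLib

/-!
# Frobenioids I, Corollary 5.4 at `C_{K/F}` (row C54-core-arith, sub-row (4), step (D3)): saturation of
# `ι : Φ(L) → Φ(L)^rlf` — an element of THE realification with integral class is an effective arithmetic divisor

Mochizuki, *The geometry of Frobenioids I: the general theory*, Kyushu J. Math. **62** (2008) 293–400,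
Cor. 5.4 p. 104 for THE realification (Prop. 5.3 p. 103) of the arithmetic Frobenioid `C_{K/F}`, Ex. 6.3 p. 113;
Thm. 6.4 (i) p. 115 ("`(Φ^rlf)^gp(L) = ArithDiv_ℝ(L)`"). [cite: MochizukiFrdI2008, Cor. 5.4 p.104]
[cite: MochizukiFrdI2008, Ex. 6.3 p.113]

PROOF-ONLY (cell abc-iut, seat abc-iut-L1-d8; no definitions). The hypothesis `hsat` of the generic lemma
`ModelFrobenioid.DataHom.div_rho_eq_of_unit_one` (`Cor54RigidityLinearSaturation.lean`) at the arithmetic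
Frobenioid: for `L = X.L`, `X ∈ FinSubextCat F K`, THE realification data `R = RealificationData.canonical Φ hΦ'` of
`Φ = arithDivisorFunctor F K` and `ι = R.toRlf` (`= (R.ofBaseData Ψ).η` for any `Ψ`):

* `FrdI.Cor54Sub.toRlf_saturated_arith` — if `x ∈ Φ(L)^rlf` has class `[x] = ι^gp(q)` for some `q ∈ Φ(L)^gp`, then
  `x = ι(w)` for an EFFECTIVE arithmetic divisor `w`.  Proof: write `q = a - b` with `a, b` effective; in the
  coordinates `Θ : (Φ(L)^rlf)^gp ↪ ADiv_ℝ(L)` of seat abc-iut-L1-d2 (`ArithRlfCoord.exists_rlfGp_coordinates`) the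
  class of `x` is `≥ 0` coefficientwise and equals the real divisor of `a` minus that of `b`; hence `b ≤ a`
  coefficientwise, `w := a - b` is an effective arithmetic divisor with `w + b = a`, so `[ι w] = [x]` and `ι w = x` by
  cancellativity of `Φ(L)^rlf` (`IsPerfFactorial.Rlf.isCancelMul`).
Nothing here bears on [IUTchIII] Cor. 3.12.
-/

noncomputable section

namespace Literature.AlgebraicGeometry.Frobenioids

namespace FrdI.Cor54Sub

open CategoryTheory Opposite NumberField IsDedekindDomain Literature.IUT.LogVolume ModelFrobenioid

variable {F : Type} [Field F] [NumberField F] {K : Type} [Field K] [Algebra F K]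

/-- **(D3) Saturation of `ι : Φ(L) → Φ(L)^rlf` at `C_{K/F}`**: an element of THE realification whose class lies in
`ι^gp(Φ(L)^gp)` is `ι` of an effective arithmetic divisor (the `hsat` hypothesis of
`ModelFrobenioid.DataHom.div_rho_eq_of_unit_one` for `h = R.ofBaseData Ψ`). [cite: MochizukiFrdI2008, Cor. 5.4 p.104] -/
theorem toRlf_saturated_arith
    (hΦ' : ∀ X : (FinSubextCat F K)ᵒᵖ, IsPerfFactorial ((arithDivisorFunctor F K).obj X))
    (Ψ : GpSubfunctor (arithDivisorFunctor F K)) (X : FinSubextCat F K)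
    (x : (RealificationData.canonical (arithDivisorFunctor F K) hΦ').rlf.obj (op X))
    (q : Algebra.GrothendieckGroup ((arithDivisorFunctor F K).obj (op X)))
    (hxq : Algebra.GrothendieckGroup.of x =
      gpApp ((RealificationData.canonical (arithDivisorFunctor F K) hΦ').ofBaseData Ψ).η (op X) q) :
    ∃ w : (arithDivisorFunctor F K).obj (op X),
      (((RealificationData.canonical (arithDivisorFunctor F K) hΦ').ofBaseData Ψ).η.app (op X)).hom w = x := by
  classical
  have hM : IsPerfFactorial (Multiplicative (EffArithDivisor X.L)) := hΦ' (op X)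
  haveI : IsCancelMul hM.Rlf := IsPerfFactorial.Rlf.isCancelMul hM
  obtain ⟨Θ, hΘinj, hΘa, hΘb, -⟩ := ArithRlfCoord.exists_rlfGp_coordinates (L := X.L) hM
  -- `q = a - b` with `a, b` effective
  obtain ⟨a₀, b₀, hq⟩ := DataHom.exists_eq_of_div_of (Φ := arithDivisorFunctor F K) X q
  obtain ⟨a, rfl⟩ : ∃ a : EffArithDivisor X.L, Multiplicative.ofAdd a = a₀ := ⟨Multiplicative.toAdd a₀, rfl⟩
  obtain ⟨b, rfl⟩ : ∃ b : EffArithDivisor X.L, Multiplicative.ofAdd b = b₀ := ⟨Multiplicative.toAdd b₀, rfl⟩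
  -- `[x] + [ι b] = [ι a]` in `(Φ(L)^rlf)^gp`
  have H : Algebra.GrothendieckGroup.of (M := hM.Rlf) x *
      Algebra.GrothendieckGroup.of (hM.toRealification (Perfection.of _ (Multiplicative.ofAdd b))) =
      Algebra.GrothendieckGroup.of (hM.toRealification (Perfection.of _ (Multiplicative.ofAdd a))) := by
    have h1 : Algebra.GrothendieckGroup.of x =
        gpApp (RealificationData.canonical (arithDivisorFunctor F K) hΦ').toRlf (op X) q := hxq
    rw [hq, map_div, gpApp_of, gpApp_of, eq_div_iff_mul_eq'] at h1
    exact h1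
  -- coordinates: `Θ[x]_p + b_p = a_p`, `Θ[x]_p ≥ 0`
  have coord : ∀ p : Place X.L,
      Multiplicative.toAdd (Θ (Algebra.GrothendieckGroup.of x)) p +
        ADivisor.ofArithDivisor X.L (EffArithDivisor.toArithDivisor X.L b) p =
      ADivisor.ofArithDivisor X.L (EffArithDivisor.toArithDivisor X.L a) p := by
    intro p
    have := congrArg (fun ξ => Multiplicative.toAdd (Θ ξ) p) H
    simp only [map_mul, hΘa, toAdd_mul, toAdd_ofAdd, Finsupp.add_apply] at this
    exact this
  have hle1 : ∀ u : FinitePlace X.L, b.1 u ≤ a.1 u := by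
    intro u
    have c := coord (Sum.inr u.maximalIdeal)
    have h0 := hΘb x (Sum.inr u.maximalIdeal)
    simp only [ADivisor.ofArithDivisor_apply_inr, FinitePlace.mk_maximalIdeal, EffArithDivisor.toArithDivisor_fst,
      Int.cast_natCast] at c h0
    exact_mod_cast (by linarith : (b.1 u : ℝ) ≤ a.1 u)
  have hle2 : ∀ v : InfinitePlace X.L, b.2 v ≤ a.2 v := by
    intro v
    have c := coord (Sum.inl v)
    have h0 := hΘb x (Sum.inl v)
    simp only [ADivisor.ofArithDivisor_apply_inl, EffArithDivisor.toArithDivisor_snd] at c h0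
    have hm : (0 : ℝ) < v.mult := by have := InfinitePlace.one_le_mult (w := v); linarith
    have : (v.mult : ℝ) * (b.2 v : ℝ) ≤ v.mult * (a.2 v : ℝ) := by nlinarith
    exact_mod_cast le_of_mul_le_mul_left this hm
  -- `w := a - b` is effective and `w + b = a`
  let w : EffArithDivisor X.L := (a.1 - b.1, fun v => a.2 v - b.2 v)
  have hwb : w + b = a := by
    refine Prod.ext ?_ ?_
    · ext u
      show (a.1 - b.1) u + b.1 u = a.1 u
      rw [Finsupp.tsub_apply, tsub_add_cancel_of_le (hle1 u)]
    · funext v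
      show (a.2 v - b.2 v) + b.2 v = a.2 v
      rw [tsub_add_cancel_of_le (hle2 v)]
  refine ⟨Multiplicative.ofAdd w, ?_⟩
  -- `[ι w] + [ι b] = [ι a] = [x] + [ι b]`
  have H2 : Algebra.GrothendieckGroup.of (hM.toRealification (Perfection.of _ (Multiplicative.ofAdd w))) *
      Algebra.GrothendieckGroup.of (hM.toRealification (Perfection.of _ (Multiplicative.ofAdd b))) =
      Algebra.GrothendieckGroup.of (hM.toRealification (Perfection.of _ (Multiplicative.ofAdd a))) := by
    rw [← map_mul, ← map_mul, ← map_mul, ← ofAdd_add, hwb]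
  have H3 : Algebra.GrothendieckGroup.of (hM.toRealification (Perfection.of _ (Multiplicative.ofAdd w))) =
      Algebra.GrothendieckGroup.of (M := hM.Rlf) x :=
    mul_right_cancel (H2.trans H.symm)
  have H4 : hM.toRealification (Perfection.of _ (Multiplicative.ofAdd w)) = x :=
    Algebra.GrothendieckGroup.of_injective H3
  exact H4

end FrdI.Cor54Sub

end Literature.AlgebraicGeometry.Frobenioids
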